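import Summits.QuantumFields.BalabanUV.Beta.GAN24.LayerLetterPsi
import Summits.QuantumFields.BalabanUV.Beta.GAN24.LayerLetterUnion
import Summits.QuantumFields.BalabanUV.Beta.GAN24.Lin4SlotDivergence

/-!
# `BalabanUV.Beta.GAN24.LayerLetterEnd` — binder row G-an2-4 ∕ (CONV-C), W-slot CT-W, route «WC-TL» ∕ (Q-R) «QR-LL», row (LAY), programme
# «(LAY-LIT) THE LITERAL's LETTER PROFILE ROWS `hS ∧ hω` OF THE (Q-R) END», PART 6b (the END adapter):
# **THE UNIT-RESCALED SUPER-BLOCK SUM OF THE SANDWICH LETTER IS A FACE LETTER IN leaf-01's CURRENCY** — for `σ Y′ = cσ • Σ_{v∈box Lc} mmRead Lc (G ∘ Ψ (Lc•Y′ + v) ∘ G)`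
# (the literal's shape, p2 PART 5) and every label box `M•y + box M`:
# `|unitS sf sm (Σ_{w∈box M} σ (M•y + w)) k′ u x z a b| ≤ K·FaceSum_{(Lc·M, y)}^{δ∕4}(u)·e^{−(δ∕32)(‖x−u‖₁+‖z−u‖₁)}` with `K` EXPLICIT
# (G-an2-4 formalisation swarm → CRUX TEAM (2), leaf prover `b2b-balaban-gan24-formalise-leaf-03`, gen 61; INTENT 6b, journal `CLAIMS.log`; names PROVISIONAL)

NOT IN PRINT; OUR BOOKKEEPING ([folklore] PART 5 `LayerLetterPsi.biLoc_sum_psi_of_faceW` with `W :=` PART 6a's `LayerLetterUnion.faceW_dilate_le` face sum, then p2 g37's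
`WardResidualSUnroll.sum_box_mul` (box nesting), this lineage's `Lin4SlotDivergence.sandwich_finset_sum`, `ExpKernelCalculus.biLoc_comp_decays` ⨾ `BalabanStepJetsSucc.biLoc_comp_right ∕
biLoc_mmRead`, `HessKerDressedUnits.unitS_apply ∕ abs_legScale_le` BY NAME; generic `d`, GENERIC `G ∕ S ∕ M ∕ M2 ∕ RM ∕ Ψ ∕ σ ∕ sf ∕ sm` — no object of an2's typed system;
0 `def`, 0 cited facts, 0 `def … : Prop`, 0 sorry).  HONEST FRAMING (cell contract, verbatim): «discharging `BetaPertH` makes Bałaban's UV stability UNCONDITIONAL — a real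
constructive-QFT result; it is NOT the continuum limit and NOT the Clay problem.»  HONEST DEPENDENCY (verbatim): «continuum YM on T⁴ ⇐ BetaPertH ∧ nine spine estimates (0/9
proved); BetaPertH ⇐ (D1) ∧ (D4) ∧ CAP+tail; G-an2-4 gates asym, D1 and NE2/3/4.»

## What (the (b)-shape of journal W-leaf03-g61-1: per sub-letter, in leaf-01's `three_weight` currency `(L, y)`, `L = Lc·M`)
Classes at ONE rate `0 < δ` for `G ∕ S ∕ M ∕ M2`, an1's mixed law `hlaw` defining `RM`, p2 PART 5's `hΨ` (generic letters, `N := Lc`), the sandwich letter `hσ`.  Then: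
* §1 `bdd_psi` (each `Ψ y₁ ν y′` is bounded — PART 5 at the one-label set + PART 3's crude count; needed only to exchange the label sum with the sandwich),
  `superblock_sum_eq` (`Σ_{w∈box M} σ (M•y + w) κ u = cσ • mmRead Lc (G ∘ (Σ_{y₁ ∈ T₁} Ψ y₁ κ u) ∘ G)`, `T₁ = (Lc·M)•y + box (Lc·M)` the fine union of the label box:
  `sum_box_mul` ⨾ `sandwich_finset_sum`).
* §2 **`biLoc_superblock_sum`** — `BiLoc (Σ_{w∈box M} σ (M•y + w) κ u) u u (Kσ·FaceSum_{(Lc·M, y)}^{δ∕4}(u)) (δ∕32)`: PART 5 at `T₁` with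
  `W := |box Lc|·e^{(δ∕4)(d+2)Lc}·FaceSum` (PART 6a `faceW_dilate_le` ⨾ `biUnion_box_image_eq`), then `G ∘ · ∘ G` (rates `δ∕8 → δ∕16 → δ∕32`), `mmRead Lc` (anchor `Lc•u ↦ u`,
  `biLoc_mmRead`), the scalar.
* §3 **`abs_unitS_superblock_sum_le`** — THE END's `hS` SHAPE for the sub-letter: `|unitS sf sm (Σ_{w∈box M} σ (M•y + w)) k′ u x z a b| ≤
  (|(sf·sm)⁻¹|·max(|sf⁻¹|,|sm⁻¹|)²·Kσ)·FaceSum_{(Lc·M, y)}^{δ∕4}(u)·e^{−(δ∕32)(‖x−u‖₁+‖z−u‖₁)}`; `faceSum_nonneg` gives the `hω` half (`ω := FaceSum`, `le_rfl`).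
READING for the END (`WardRemainderEndThree` ∕ leaf-01 `three_weight` at blocking `L = Lc^{k+1}`, block label `y ∈ Λ_n`): with `M := Lc^k` the sub-letter
`S_m^{(y)} = unitS_{m+1}(Σ_{w∈box(Lc^k)} σ m ((Lc^k)•y + w))` meets `hS ∧ hω` VERBATIM with `Cs := K`, `m′ := δ∕32`, rate `δ∕4` in `hω`, faces of `(Lc^(k+1))•y + box (Lc^(k+1))`;
the full `S_m` at label `Y ∈ Λ_{n+1}` is `Σ_{y ∈ Lc•Y + box Lc} S_m^{(y)}` (box nesting).  HONEST — WHAT IS DISPLAYED, NOT DISCHARGED: the constant `K` is EXPLICIT in the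
level's class constants `CG, Cs, Cm, C2, |cH|, |c|, |cσ|` and units `sf, sm`; it is LEVEL-FREE exactly when those are, i.e. when the literal's `G_m = coDressKBmAt ρ Lc (KInvStep Lc m)`,
`SpureRecAt … m`, `M1At … m`, `M2Of … mixFF m`, `(stepScale m·Lc^{d+1})⁻¹`, `−Lc^{d+1}·wE (m+1)` have level-free classes IN UNITS (`unit_remainder_factor`) — NOT in the tree
(`decays_coDressKBmAt_KInvStep` is `∃ δ C` per level).  DISCHARGES NO ROW by itself: the instantiation at the literal (ten `rfl`∕`exact` lines per object) is the OWNER's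
assembly; (LT), K-LL-4, the (S) row, the END and (Q-R) are NOT here; 0 estimate of Bałaban's; NOTHING of (Q-R) ∕ (LT) ∕ (Q-L) ∕ (C) ∕ (S) ∕ «T2Shape» ∕ «T2Drift» ∕ (hW, hWall)
discharged; NEVER «G-an2-4 closed» as (CONV-C); NOT D1, NOT `BetaPertH`, NOT continuum, NOT Clay.  2026-08-22.
-/

noncomputable section

namespace Summit.QuantumFields.BalabanUV.Beta.GAN24.LayerLetterEnd

open Finset
open scoped BigOperators
open Literature.MathematicalPhysics.QuantumFieldTheory
open Literature.MathematicalPhysics.QuantumFieldTheory.Balaban1983to89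
open Literature.MathematicalPhysics.QuantumFieldTheory.Balaban1983to89.Beta
open Literature.MathematicalPhysics.QuantumFieldTheory.Balaban1983to89.B12Sec2to5 (l1 l1_nonneg)
open B6BondElimination (unitVec)
open ExpKernelCalculus (MKer Site BiLoc Decays VertexFamily comp Zl Zl_nonneg biLoc_comp_decays)
open OneStepResolventKernel (Fib LocStencil wsum)
open SecondOrderResponse (colM vertexOfM dM LocStencilFM)
open InterLevelTransport (cwsum)
open KernelWard (divV Bdd bdd_of_biLoc)
open StepJetData (biLoc_weaken decays_weaken)
open BalabanStepJetsSucc (mmRead biLoc_mmRead biLoc_comp_right)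
open AffineAveraging (box toSite)
open AxialProjector (toSite_injective)
open Summit.QuantumFields.BalabanUV.Beta.ChartConjugation (conjV)
open Summit.QuantumFields.BalabanUV.Beta.BorderedHessian (diagK)
open Summit.QuantumFields.BalabanUV.Beta.AveragingWardRootedStencils (legInd)
open Summit.QuantumFields.BalabanUV.Beta.KernelWardRelative (gaugeWt)
open Summit.QuantumFields.BalabanUV.Beta.HessKerDressedUnits (unitS unitS_apply legScale abs_legScale_le)
open Summit.QuantumFields.BalabanUV.Beta.GAN24.WardResidualSUnroll (sum_box_mul)
open Summit.QuantumFields.BalabanUV.Beta.GAN24.Lin4SlotDivergence (sandwich_finset_sum)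
open Summit.QuantumFields.BalabanUV.Beta.GAN24.LayerLetterFaces (faceW_nonneg)
open Summit.QuantumFields.BalabanUV.Beta.GAN24.LayerLetterMixed (faceW_le_card)
open Summit.QuantumFields.BalabanUV.Beta.GAN24.LayerLetterPsi (biLoc_sum_psi_of_faceW biLoc_smul_abs)
open Summit.QuantumFields.BalabanUV.Beta.GAN24.LayerLetterUnion (biUnion_box_image_eq faceW_dilate_le)

variable {d Lc : ℕ} [NeZero Lc]

/-- `1 ≤ Lc`. -/
private theorem one_le_Lc (Lc : ℕ) [NeZero Lc] : 1 ≤ Lc := Nat.one_le_iff_ne_zero.2 (NeZero.ne Lc)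

/-! ## §0 The common hypotheses, as a section -/

section Letter

variable {G : MKer (d + 1) (Fib d)} {CG δ : ℝ}
  {S : Fin (d + 1) → Site (d + 1) → MKer (d + 1) (Fib d)} {Cs : ℝ}
  {M : Fin (d + 1) → Site (d + 1) → MKer (d + 1) (Fib d)} {Cm : ℝ}
  {M2 : Fin (d + 1) → Site (d + 1) → Fin (d + 1) → Site (d + 1) → MKer (d + 1) (Fib d)} {C2 : ℝ}
  {RM : Site (d + 1) → Fin (d + 1) → Site (d + 1) → MKer (d + 1) (Fib d)} {cH c cσ : ℝ} {ρ : Site (d + 1)}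
  {Ψ : Site (d + 1) → Fin (d + 1) → Site (d + 1) → MKer (d + 1) (Fib d)}
  {σ : Site (d + 1) → Fin (d + 1) → Site (d + 1) → MKer (d + 1) (Fib d)}

/-- [folklore] The nonnegative face sum of a block in leaf-01's currency. -/
theorem faceSum_nonneg (L : ℕ) (y : Site (d + 1)) (r : ℝ) (u : Site (d + 1)) :
    0 ≤ ∑ μ : Fin (d + 1),
      (∑ v ∈ ((box (d + 1) L).filter (fun t => t μ = L - 1)).image (fun t => (L : ℤ) • y + toSite t), Real.exp (-r * l1 (v - u))
        + ∑ v ∈ ((box (d + 1) L).filter (fun t => t μ = 0)).image (fun t => (L : ℤ) • y + toSite t - unitVec μ), Real.exp (-r * l1 (v - u))) :=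
  Finset.sum_nonneg fun _ _ => add_nonneg (Finset.sum_nonneg fun _ _ => (Real.exp_pos _).le) (Finset.sum_nonneg fun _ _ => (Real.exp_pos _).le)

/-! ## §1 Boundedness of `Ψ`; the super-block sum as ONE sandwich of the label sum -/

/-- [folklore] EACH `Ψ y₁ ν y′` IS BOUNDED (PART 5 at the one-label set `{y₁}` with its own face weight, crudely counted by PART 3's `faceW_le_card`). -/
theorem bdd_psi (hG : Decays G CG δ) (hδ : 0 < δ) (hS : LocStencil S Cs δ) (hM : VertexFamily M Lc Cm δ) (hM2 : LocStencilFM Lc M2 C2 δ)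
    (hlaw : ∀ (y : Site (d + 1)) (ρ' : Fin (d + 1)) (w : Site (d + 1)),
      cH • ∑ v ∈ box (d + 1) Lc, divV (fun κ u => M2 κ u ρ' w) ((Lc : ℤ) • y + toSite v) =
        comp (M ρ' w) (diagK (((1 : ℝ) / 2) • ∑ v ∈ box (d + 1) Lc, legInd ρ ((Lc : ℤ) • y + toSite v)))
          - comp (diagK (((1 : ℝ) / 2) • ∑ v ∈ box (d + 1) Lc, legInd ρ ((Lc : ℤ) • y + toSite v))) (M ρ' w) + RM y ρ' w)
    (hΨ : ∀ (y : Site (d + 1)) (ν : Fin (d + 1)) (y' : Site (d + 1)), Ψ y ν y' =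
      vertexOfM G Lc (RM y) ν y'
      + (1 / 2 : ℝ) • (dM (conjV G (diagK (((1 : ℝ) / 2) • ∑ v ∈ box (d + 1) Lc, legInd ρ ((Lc : ℤ) • y + toSite v)))) Lc S M ν y'
        - c • (∑ κ, wsum (fun u => ∑' x₂, ∑ κ₂,
              comp G (dM G Lc S M ν y') u x₂ (Sum.inl κ) (Sum.inl κ₂) * gaugeWt Lc y κ₂ x₂) (S κ)
            + ∑ ρ', cwsum Lc (fun w => ∑' x₂, ∑ κ₂,
              comp G (dM G Lc S M ν y') ((Lc : ℤ) • w) x₂ (Sum.inr ρ') (Sum.inl κ₂) * gaugeWt Lc y κ₂ x₂) (M ρ'))))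
    (y₁ : Site (d + 1)) (ν : Fin (d + 1)) (y' : Site (d + 1)) : ∃ B : ℝ, Bdd (Ψ y₁ ν y') B := by
  have h := biLoc_sum_psi_of_faceW hG hδ (one_le_Lc Lc) hS hM hM2 hlaw hΨ {y₁} ν y' le_rfl
  rw [Finset.sum_singleton] at h
  exact ⟨_, bdd_of_biLoc h (by linarith)⟩

/-- [folklore] **THE SUPER-BLOCK SUM IS ONE SANDWICH OF THE LABEL SUM**: with the sandwich letter `σ Y′ κ u = cσ • Σ_{v∈box Lc} mmRead Lc (G ∘ Ψ (Lc•Y′ + v) κ u ∘ G)`,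
`Σ_{w∈box M} σ (M•y + w) κ u = cσ • mmRead Lc (G ∘ (Σ_{y₁ ∈ (box (Lc·M)).image ((Lc·M)•y + ·)} Ψ y₁ κ u) ∘ G)` (`sum_box_mul` ⨾ `sandwich_finset_sum` ⨾ `sum_image`). -/
theorem superblock_sum_eq (hG : Decays G CG δ) (hδ : 0 < δ) (hS : LocStencil S Cs δ) (hM : VertexFamily M Lc Cm δ) (hM2 : LocStencilFM Lc M2 C2 δ)
    (hlaw : ∀ (y : Site (d + 1)) (ρ' : Fin (d + 1)) (w : Site (d + 1)),
      cH • ∑ v ∈ box (d + 1) Lc, divV (fun κ u => M2 κ u ρ' w) ((Lc : ℤ) • y + toSite v) =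
        comp (M ρ' w) (diagK (((1 : ℝ) / 2) • ∑ v ∈ box (d + 1) Lc, legInd ρ ((Lc : ℤ) • y + toSite v)))
          - comp (diagK (((1 : ℝ) / 2) • ∑ v ∈ box (d + 1) Lc, legInd ρ ((Lc : ℤ) • y + toSite v))) (M ρ' w) + RM y ρ' w)
    (hΨ : ∀ (y : Site (d + 1)) (ν : Fin (d + 1)) (y' : Site (d + 1)), Ψ y ν y' =
      vertexOfM G Lc (RM y) ν y'
      + (1 / 2 : ℝ) • (dM (conjV G (diagK (((1 : ℝ) / 2) • ∑ v ∈ box (d + 1) Lc, legInd ρ ((Lc : ℤ) • y + toSite v)))) Lc S M ν y'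
        - c • (∑ κ, wsum (fun u => ∑' x₂, ∑ κ₂,
              comp G (dM G Lc S M ν y') u x₂ (Sum.inl κ) (Sum.inl κ₂) * gaugeWt Lc y κ₂ x₂) (S κ)
            + ∑ ρ', cwsum Lc (fun w => ∑' x₂, ∑ κ₂,
              comp G (dM G Lc S M ν y') ((Lc : ℤ) • w) x₂ (Sum.inr ρ') (Sum.inl κ₂) * gaugeWt Lc y κ₂ x₂) (M ρ'))))
    (hσ : ∀ (Y' : Site (d + 1)) (κ : Fin (d + 1)) (u : Site (d + 1)), σ Y' κ u =
      cσ • ∑ v ∈ box (d + 1) Lc, mmRead Lc (comp (comp G (Ψ ((Lc : ℤ) • Y' + toSite v) κ u)) G))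
    (M' : ℕ) (y : Site (d + 1)) (κ : Fin (d + 1)) (u : Site (d + 1)) :
    ∑ w ∈ box (d + 1) M', σ ((M' : ℤ) • y + toSite w) κ u
      = cσ • mmRead Lc (comp (comp G (∑ y₁ ∈ (box (d + 1) (Lc * M')).image (fun s => ((Lc * M' : ℕ) : ℤ) • y + toSite s), Ψ y₁ κ u)) G) := by
  classical
  simp only [hσ]
  rw [← Finset.smul_sum]
  congr 1
  rw [← sum_box_mul (one_le_Lc Lc) M' (fun y₁ => mmRead Lc (comp (comp G (Ψ y₁ κ u)) G)) y,
    Finset.sum_image (fun s _ s' _ h => toSite_injective (add_left_cancel h))]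
  choose B hB using fun y₁ => bdd_psi hG hδ hS hM hM2 hlaw hΨ y₁ κ u
  exact (sandwich_finset_sum _ hG hδ Lc (V := fun s => Ψ (((Lc * M' : ℕ) : ℤ) • y + toSite s) κ u) (fun s => hB _)).symm

/-! ## §2 The super-block sum is a face letter in the slot lattice -/

/-- [folklore] **THE SUPER-BLOCK SUM OF THE SANDWICH LETTER IS A FACE LETTER IN leaf-01's CURRENCY.**  For every label box `M•y + box M`, slot `(κ, u)`:
`BiLoc (Σ_{w∈box M} σ (M•y + w) κ u) u u (Kσ·FaceSum_{(Lc·M, y)}^{δ∕4}(u)) (δ∕32)`, `Kσ` displayed (PART 5 at the fine union `T₁ = (Lc·M)•y + box (Lc·M)` of the label box with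
`W := |box Lc|·e^{(δ∕4)(d+2)Lc}·FaceSum` by PART 6a; then `G ∘ · ∘ G`, `mmRead Lc`, the scalar). -/
theorem biLoc_superblock_sum (hG : Decays G CG δ) (hδ : 0 < δ) (hS : LocStencil S Cs δ) (hM : VertexFamily M Lc Cm δ) (hM2 : LocStencilFM Lc M2 C2 δ)
    (hlaw : ∀ (y : Site (d + 1)) (ρ' : Fin (d + 1)) (w : Site (d + 1)),
      cH • ∑ v ∈ box (d + 1) Lc, divV (fun κ u => M2 κ u ρ' w) ((Lc : ℤ) • y + toSite v) =
        comp (M ρ' w) (diagK (((1 : ℝ) / 2) • ∑ v ∈ box (d + 1) Lc, legInd ρ ((Lc : ℤ) • y + toSite v)))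
          - comp (diagK (((1 : ℝ) / 2) • ∑ v ∈ box (d + 1) Lc, legInd ρ ((Lc : ℤ) • y + toSite v))) (M ρ' w) + RM y ρ' w)
    (hΨ : ∀ (y : Site (d + 1)) (ν : Fin (d + 1)) (y' : Site (d + 1)), Ψ y ν y' =
      vertexOfM G Lc (RM y) ν y'
      + (1 / 2 : ℝ) • (dM (conjV G (diagK (((1 : ℝ) / 2) • ∑ v ∈ box (d + 1) Lc, legInd ρ ((Lc : ℤ) • y + toSite v)))) Lc S M ν y'
        - c • (∑ κ, wsum (fun u => ∑' x₂, ∑ κ₂,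
              comp G (dM G Lc S M ν y') u x₂ (Sum.inl κ) (Sum.inl κ₂) * gaugeWt Lc y κ₂ x₂) (S κ)
            + ∑ ρ', cwsum Lc (fun w => ∑' x₂, ∑ κ₂,
              comp G (dM G Lc S M ν y') ((Lc : ℤ) • w) x₂ (Sum.inr ρ') (Sum.inl κ₂) * gaugeWt Lc y κ₂ x₂) (M ρ'))))
    (hσ : ∀ (Y' : Site (d + 1)) (κ : Fin (d + 1)) (u : Site (d + 1)), σ Y' κ u =
      cσ • ∑ v ∈ box (d + 1) Lc, mmRead Lc (comp (comp G (Ψ ((Lc : ℤ) • Y' + toSite v) κ u)) G))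
    (M' : ℕ) (y : Site (d + 1)) (κ : Fin (d + 1)) (u : Site (d + 1)) :
    BiLoc (∑ w ∈ box (d + 1) M', σ ((M' : ℤ) • y + toSite w) κ u) u u
      (|cσ| * ((Fintype.card (Fib d) : ℝ) * (((Fintype.card (Fib d) : ℝ) * (CG * ((((1 / 4 : ℝ) * (((d : ℝ) + 1) * CG * Real.exp (δ * l1 ρ) * (Cs + Cm) * Zl (d + 1) (δ / 4))
            + ((d : ℝ) + 1) * CG * (|cH| * C2 + (1 / 2 : ℝ) * Cm * Real.exp (δ * l1 ρ)) * Zl (d + 1) (δ / 6)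
            + (1 / 2 : ℝ) * |c| * (((d : ℝ) + 1)
                * ((Fintype.card (Fib d) : ℝ) * (CG * (((d + 1 : ℕ) : ℝ) * (CG * Cs * Zl (d + 1) (δ / 2)) + ((d + 1 : ℕ) : ℝ) * (CG * Cm * Zl (d + 1) (δ / 2))))
                    * Zl (d + 1) (δ / 2 - δ / 4))
                * (Cs + Cm) * Zl (d + 1) (δ / 4 / 2)))) * ((((box (d + 1) Lc).card : ℝ) * Real.exp ((δ / 4) * (((d : ℝ) + 2) * Lc))) * (∑ μ : Fin (d + 1),
            (∑ v ∈ ((box (d + 1) (Lc * M')).filter (fun t => t μ = Lc * M' - 1)).image (fun t => ((Lc * M' : ℕ) : ℤ) • y + toSite t),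
                Real.exp (-(δ / 4) * l1 (v - u))
              + ∑ v ∈ ((box (d + 1) (Lc * M')).filter (fun t => t μ = 0)).image (fun t => ((Lc * M' : ℕ) : ℤ) • y + toSite t - unitVec μ),
                  Real.exp (-(δ / 4) * l1 (v - u))))))) * Zl (d + 1) (δ / 8 - δ / 16)) * CG) * Zl (d + 1) (δ / 16 - δ / 32))) (δ / 32) := by
  classical
  have hCG : 0 ≤ CG := hG.nonneg (Sum.inl 0)
  rw [superblock_sum_eq hG hδ hS hM hM2 hlaw hΨ hσ M' y κ u]
  -- PART 5 at the fine union `T₁` of the label box, with `W` from PART 6a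
  have hW := faceW_dilate_le (d := d) (one_le_Lc Lc) (Lc * M') y (show (0 : ℝ) ≤ δ / 4 by linarith) u
  rw [← biUnion_box_image_eq (one_le_Lc Lc) (Lc * M') y] at hW
  have hΨT := biLoc_sum_psi_of_faceW hG hδ (one_le_Lc Lc) hS hM hM2 hlaw hΨ
    ((box (d + 1) (Lc * M')).image (fun s => ((Lc * M' : ℕ) : ℤ) • y + toSite s)) κ u hW
  -- the sandwich `G ∘ · ∘ G`: rates δ/8 → δ/16 → δ/32
  have hG8 : Decays G CG (δ / 8) := decays_weaken hG le_rfl (by linarith)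
  have h1 := biLoc_comp_decays hG8 hΨT (show (0 : ℝ) ≤ δ / 16 by linarith) (by linarith)
  have hG16 : Decays G CG (δ / 16) := decays_weaken hG le_rfl (by linarith)
  have h2 := biLoc_comp_right h1 hG16 (show (0 : ℝ) ≤ δ / 32 by linarith) (by linarith)
  -- `mmRead Lc`: anchor `Lc•u ↦ u`
  have h3 := biLoc_mmRead (one_le_Lc Lc) h2 (by linarith)
  -- the scalar
  exact biLoc_smul_abs h3 cσ

/-! ## §3 In units: the END's `hS` shape for the sub-letter -/

/-- [folklore] **THE END's `hS` FOR THE SUB-LETTER OF ONE LABEL BOX, `hω` BEING `FaceSum` ITSELF.**  For every `sf sm`, label box `M•y + box M`, slot and entry: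
`|unitS sf sm (Σ_{w∈box M} σ (M•y + w)) k′ u x z a b| ≤ (|(sf·sm)⁻¹|·max(|sf⁻¹|,|sm⁻¹|)²·Kσ)·FaceSum_{(Lc·M, y)}^{δ∕4}(u)·e^{−(δ∕32)(‖x−u‖₁+‖z−u‖₁)}` (§2 ⨾ `unitS_apply` ⨾
`abs_legScale_le`).  With `M := Lc^k`, `y ∈ Λ_n`, `(sf, sm) := (sfStep Lc (m+1), smStep d Lc (m+1))` this is `hS` of `WardRemainderEndThree.wLocStencil_unitS_of_layer` ∕ leaf-01's
`three_weight` for `S_m^{(y)}` at blocking `Lc^(k+1)`, and `hω := ⟨faceSum_nonneg, le_rfl⟩`; the constant is level-free iff the displayed classes are (W-leaf03-g61-1). -/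
theorem abs_unitS_superblock_sum_le (hG : Decays G CG δ) (hδ : 0 < δ) (hS : LocStencil S Cs δ) (hM : VertexFamily M Lc Cm δ) (hM2 : LocStencilFM Lc M2 C2 δ)
    (hlaw : ∀ (y : Site (d + 1)) (ρ' : Fin (d + 1)) (w : Site (d + 1)),
      cH • ∑ v ∈ box (d + 1) Lc, divV (fun κ u => M2 κ u ρ' w) ((Lc : ℤ) • y + toSite v) =
        comp (M ρ' w) (diagK (((1 : ℝ) / 2) • ∑ v ∈ box (d + 1) Lc, legInd ρ ((Lc : ℤ) • y + toSite v)))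
          - comp (diagK (((1 : ℝ) / 2) • ∑ v ∈ box (d + 1) Lc, legInd ρ ((Lc : ℤ) • y + toSite v))) (M ρ' w) + RM y ρ' w)
    (hΨ : ∀ (y : Site (d + 1)) (ν : Fin (d + 1)) (y' : Site (d + 1)), Ψ y ν y' =
      vertexOfM G Lc (RM y) ν y'
      + (1 / 2 : ℝ) • (dM (conjV G (diagK (((1 : ℝ) / 2) • ∑ v ∈ box (d + 1) Lc, legInd ρ ((Lc : ℤ) • y + toSite v)))) Lc S M ν y'
        - c • (∑ κ, wsum (fun u => ∑' x₂, ∑ κ₂,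
              comp G (dM G Lc S M ν y') u x₂ (Sum.inl κ) (Sum.inl κ₂) * gaugeWt Lc y κ₂ x₂) (S κ)
            + ∑ ρ', cwsum Lc (fun w => ∑' x₂, ∑ κ₂,
              comp G (dM G Lc S M ν y') ((Lc : ℤ) • w) x₂ (Sum.inr ρ') (Sum.inl κ₂) * gaugeWt Lc y κ₂ x₂) (M ρ'))))
    (hσ : ∀ (Y' : Site (d + 1)) (κ : Fin (d + 1)) (u : Site (d + 1)), σ Y' κ u =
      cσ • ∑ v ∈ box (d + 1) Lc, mmRead Lc (comp (comp G (Ψ ((Lc : ℤ) • Y' + toSite v) κ u)) G))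
    (sf sm : ℝ) (M' : ℕ) (y : Site (d + 1)) (κ : Fin (d + 1)) (u x z : Site (d + 1)) (a b : Fib d) :
    |unitS sf sm (fun κ' u' => ∑ w ∈ box (d + 1) M', σ ((M' : ℤ) • y + toSite w) κ' u') κ u x z a b|
      ≤ (|(sf * sm)⁻¹| * (max |sf⁻¹| |sm⁻¹|) ^ 2 * (|cσ| * ((Fintype.card (Fib d) : ℝ) * (((Fintype.card (Fib d) : ℝ) * (CG * ((((1 / 4 : ℝ) * (((d : ℝ) + 1) * CG * Real.exp (δ * l1 ρ) * (Cs + Cm) * Zl (d + 1) (δ / 4))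
            + ((d : ℝ) + 1) * CG * (|cH| * C2 + (1 / 2 : ℝ) * Cm * Real.exp (δ * l1 ρ)) * Zl (d + 1) (δ / 6)
            + (1 / 2 : ℝ) * |c| * (((d : ℝ) + 1)
                * ((Fintype.card (Fib d) : ℝ) * (CG * (((d + 1 : ℕ) : ℝ) * (CG * Cs * Zl (d + 1) (δ / 2)) + ((d + 1 : ℕ) : ℝ) * (CG * Cm * Zl (d + 1) (δ / 2))))
                    * Zl (d + 1) (δ / 2 - δ / 4))
                * (Cs + Cm) * Zl (d + 1) (δ / 4 / 2)))) * (((box (d + 1) Lc).card : ℝ) * Real.exp ((δ / 4) * (((d : ℝ) + 2) * Lc))))) * Zl (d + 1) (δ / 8 - δ / 16)) * CG) * Zl (d + 1) (δ / 16 - δ / 32))))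
        * (∑ μ : Fin (d + 1),
            (∑ v ∈ ((box (d + 1) (Lc * M')).filter (fun t => t μ = Lc * M' - 1)).image (fun t => ((Lc * M' : ℕ) : ℤ) • y + toSite t),
                Real.exp (-(δ / 4) * l1 (v - u))
              + ∑ v ∈ ((box (d + 1) (Lc * M')).filter (fun t => t μ = 0)).image (fun t => ((Lc * M' : ℕ) : ℤ) • y + toSite t - unitVec μ),
                  Real.exp (-(δ / 4) * l1 (v - u))))
        * Real.exp (-(δ / 32) * (l1 (x - u) + l1 (z - u))) := by
  have h := biLoc_superblock_sum hG hδ hS hM hM2 hlaw hΨ hσ M' y κ u x z a b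
  have hFS := faceSum_nonneg (d := d) (Lc * M') y (δ / 4) u
  rw [unitS_apply]
  have hla := abs_legScale_le sf⁻¹ sm⁻¹ a
  have hlb := abs_legScale_le sf⁻¹ sm⁻¹ b
  have hmax : 0 ≤ max |sf⁻¹| |sm⁻¹| := (abs_nonneg _).trans hla
  rw [abs_mul, abs_mul, abs_mul]
  set X := (∑ w ∈ box (d + 1) M', σ ((M' : ℤ) • y + toSite w) κ u) x z a b with hX
  have hX0 : 0 ≤ |X| := abs_nonneg _
  calc |(sf * sm)⁻¹| * (|legScale sf⁻¹ sm⁻¹ a| * |X| * |legScale sf⁻¹ sm⁻¹ b|)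
      ≤ |(sf * sm)⁻¹| * ((max |sf⁻¹| |sm⁻¹|) * |X| * (max |sf⁻¹| |sm⁻¹|)) :=
        mul_le_mul_of_nonneg_left (mul_le_mul (mul_le_mul_of_nonneg_right hla hX0) hlb (abs_nonneg _) (by positivity)) (abs_nonneg _)
    _ = |(sf * sm)⁻¹| * (max |sf⁻¹| |sm⁻¹|) ^ 2 * |X| := by ring
    _ ≤ _ := by
        have hK0 : 0 ≤ |(sf * sm)⁻¹| * (max |sf⁻¹| |sm⁻¹|) ^ 2 := by positivity
        have := mul_le_mul_of_nonneg_left h hK0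
        refine this.trans (le_of_eq ?_)
        ring

/-- [folklore] The same with the super-block sum written as a SUM OF TABLES (the END's `unitS_{m+1} (Σ_{w∈box} σ m (…))` spelling; `Finset.sum_apply`). -/
theorem abs_unitS_superblock_sum_le' (hG : Decays G CG δ) (hδ : 0 < δ) (hS : LocStencil S Cs δ) (hM : VertexFamily M Lc Cm δ) (hM2 : LocStencilFM Lc M2 C2 δ)
    (hlaw : ∀ (y : Site (d + 1)) (ρ' : Fin (d + 1)) (w : Site (d + 1)),
      cH • ∑ v ∈ box (d + 1) Lc, divV (fun κ u => M2 κ u ρ' w) ((Lc : ℤ) • y + toSite v) =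
        comp (M ρ' w) (diagK (((1 : ℝ) / 2) • ∑ v ∈ box (d + 1) Lc, legInd ρ ((Lc : ℤ) • y + toSite v)))
          - comp (diagK (((1 : ℝ) / 2) • ∑ v ∈ box (d + 1) Lc, legInd ρ ((Lc : ℤ) • y + toSite v))) (M ρ' w) + RM y ρ' w)
    (hΨ : ∀ (y : Site (d + 1)) (ν : Fin (d + 1)) (y' : Site (d + 1)), Ψ y ν y' =
      vertexOfM G Lc (RM y) ν y'
      + (1 / 2 : ℝ) • (dM (conjV G (diagK (((1 : ℝ) / 2) • ∑ v ∈ box (d + 1) Lc, legInd ρ ((Lc : ℤ) • y + toSite v)))) Lc S M ν y'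
        - c • (∑ κ, wsum (fun u => ∑' x₂, ∑ κ₂,
              comp G (dM G Lc S M ν y') u x₂ (Sum.inl κ) (Sum.inl κ₂) * gaugeWt Lc y κ₂ x₂) (S κ)
            + ∑ ρ', cwsum Lc (fun w => ∑' x₂, ∑ κ₂,
              comp G (dM G Lc S M ν y') ((Lc : ℤ) • w) x₂ (Sum.inr ρ') (Sum.inl κ₂) * gaugeWt Lc y κ₂ x₂) (M ρ'))))
    (hσ : ∀ (Y' : Site (d + 1)) (κ : Fin (d + 1)) (u : Site (d + 1)), σ Y' κ u =
      cσ • ∑ v ∈ box (d + 1) Lc, mmRead Lc (comp (comp G (Ψ ((Lc : ℤ) • Y' + toSite v) κ u)) G))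
    (sf sm : ℝ) (M' : ℕ) (y : Site (d + 1)) (κ : Fin (d + 1)) (u x z : Site (d + 1)) (a b : Fib d) :
    |unitS sf sm (∑ w ∈ box (d + 1) M', σ ((M' : ℤ) • y + toSite w)) κ u x z a b|
      ≤ (|(sf * sm)⁻¹| * (max |sf⁻¹| |sm⁻¹|) ^ 2 * (|cσ| * ((Fintype.card (Fib d) : ℝ) * (((Fintype.card (Fib d) : ℝ) * (CG * ((((1 / 4 : ℝ) * (((d : ℝ) + 1) * CG * Real.exp (δ * l1 ρ) * (Cs + Cm) * Zl (d + 1) (δ / 4))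
            + ((d : ℝ) + 1) * CG * (|cH| * C2 + (1 / 2 : ℝ) * Cm * Real.exp (δ * l1 ρ)) * Zl (d + 1) (δ / 6)
            + (1 / 2 : ℝ) * |c| * (((d : ℝ) + 1)
                * ((Fintype.card (Fib d) : ℝ) * (CG * (((d + 1 : ℕ) : ℝ) * (CG * Cs * Zl (d + 1) (δ / 2)) + ((d + 1 : ℕ) : ℝ) * (CG * Cm * Zl (d + 1) (δ / 2))))
                    * Zl (d + 1) (δ / 2 - δ / 4))
                * (Cs + Cm) * Zl (d + 1) (δ / 4 / 2)))) * (((box (d + 1) Lc).card : ℝ) * Real.exp ((δ / 4) * (((d : ℝ) + 2) * Lc))))) * Zl (d + 1) (δ / 8 - δ / 16)) * CG) * Zl (d + 1) (δ / 16 - δ / 32))))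
        * (∑ μ : Fin (d + 1),
            (∑ v ∈ ((box (d + 1) (Lc * M')).filter (fun t => t μ = Lc * M' - 1)).image (fun t => ((Lc * M' : ℕ) : ℤ) • y + toSite t),
                Real.exp (-(δ / 4) * l1 (v - u))
              + ∑ v ∈ ((box (d + 1) (Lc * M')).filter (fun t => t μ = 0)).image (fun t => ((Lc * M' : ℕ) : ℤ) • y + toSite t - unitVec μ),
                  Real.exp (-(δ / 4) * l1 (v - u))))
        * Real.exp (-(δ / 32) * (l1 (x - u) + l1 (z - u))) := by
  have e : (∑ w ∈ box (d + 1) M', σ ((M' : ℤ) • y + toSite w)) = fun κ' u' => ∑ w ∈ box (d + 1) M', σ ((M' : ℤ) • y + toSite w) κ' u' := by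
    funext κ' u'
    simp only [Finset.sum_apply]
  rw [e]
  exact abs_unitS_superblock_sum_le hG hδ hS hM hM2 hlaw hΨ hσ sf sm M' y κ u x z a b

/-- [folklore] The same at the END's indexing: label box of side `Lc^k` at the Λ_n-label `y`, faces of the ONE block of side `Lc^(k+1)` (the OWNER's
`WardRemainderEndThreeSplit` ∕ leaf-01's `three_weight` at `(L, y_v) = (Lc^(k+1), Lc•Y + toSite v)`: take `y := Lc•Y + toSite v`). -/
theorem abs_unitS_superblock_sum_le_pow (hG : Decays G CG δ) (hδ : 0 < δ) (hS : LocStencil S Cs δ) (hM : VertexFamily M Lc Cm δ) (hM2 : LocStencilFM Lc M2 C2 δ)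
    (hlaw : ∀ (y : Site (d + 1)) (ρ' : Fin (d + 1)) (w : Site (d + 1)),
      cH • ∑ v ∈ box (d + 1) Lc, divV (fun κ u => M2 κ u ρ' w) ((Lc : ℤ) • y + toSite v) =
        comp (M ρ' w) (diagK (((1 : ℝ) / 2) • ∑ v ∈ box (d + 1) Lc, legInd ρ ((Lc : ℤ) • y + toSite v)))
          - comp (diagK (((1 : ℝ) / 2) • ∑ v ∈ box (d + 1) Lc, legInd ρ ((Lc : ℤ) • y + toSite v))) (M ρ' w) + RM y ρ' w)
    (hΨ : ∀ (y : Site (d + 1)) (ν : Fin (d + 1)) (y' : Site (d + 1)), Ψ y ν y' =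
      vertexOfM G Lc (RM y) ν y'
      + (1 / 2 : ℝ) • (dM (conjV G (diagK (((1 : ℝ) / 2) • ∑ v ∈ box (d + 1) Lc, legInd ρ ((Lc : ℤ) • y + toSite v)))) Lc S M ν y'
        - c • (∑ κ, wsum (fun u => ∑' x₂, ∑ κ₂,
              comp G (dM G Lc S M ν y') u x₂ (Sum.inl κ) (Sum.inl κ₂) * gaugeWt Lc y κ₂ x₂) (S κ)
            + ∑ ρ', cwsum Lc (fun w => ∑' x₂, ∑ κ₂,
              comp G (dM G Lc S M ν y') ((Lc : ℤ) • w) x₂ (Sum.inr ρ') (Sum.inl κ₂) * gaugeWt Lc y κ₂ x₂) (M ρ'))))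
    (hσ : ∀ (Y' : Site (d + 1)) (κ : Fin (d + 1)) (u : Site (d + 1)), σ Y' κ u =
      cσ • ∑ v ∈ box (d + 1) Lc, mmRead Lc (comp (comp G (Ψ ((Lc : ℤ) • Y' + toSite v) κ u)) G))
    (sf sm : ℝ) (k : ℕ) (y : Site (d + 1)) (κ : Fin (d + 1)) (u x z : Site (d + 1)) (a b : Fib d) :
    |unitS sf sm (∑ w ∈ box (d + 1) (Lc ^ k), σ (((Lc ^ k : ℕ) : ℤ) • y + toSite w)) κ u x z a b|
      ≤ (|(sf * sm)⁻¹| * (max |sf⁻¹| |sm⁻¹|) ^ 2 * (|cσ| * ((Fintype.card (Fib d) : ℝ) * (((Fintype.card (Fib d) : ℝ) * (CG * ((((1 / 4 : ℝ) * (((d : ℝ) + 1) * CG * Real.exp (δ * l1 ρ) * (Cs + Cm) * Zl (d + 1) (δ / 4))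
            + ((d : ℝ) + 1) * CG * (|cH| * C2 + (1 / 2 : ℝ) * Cm * Real.exp (δ * l1 ρ)) * Zl (d + 1) (δ / 6)
            + (1 / 2 : ℝ) * |c| * (((d : ℝ) + 1)
                * ((Fintype.card (Fib d) : ℝ) * (CG * (((d + 1 : ℕ) : ℝ) * (CG * Cs * Zl (d + 1) (δ / 2)) + ((d + 1 : ℕ) : ℝ) * (CG * Cm * Zl (d + 1) (δ / 2))))
                    * Zl (d + 1) (δ / 2 - δ / 4))
                * (Cs + Cm) * Zl (d + 1) (δ / 4 / 2)))) * (((box (d + 1) Lc).card : ℝ) * Real.exp ((δ / 4) * (((d : ℝ) + 2) * Lc))))) * Zl (d + 1) (δ / 8 - δ / 16)) * CG) * Zl (d + 1) (δ / 16 - δ / 32))))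
        * (∑ μ : Fin (d + 1),
            (∑ v ∈ ((box (d + 1) (Lc ^ (k + 1))).filter (fun t => t μ = Lc ^ (k + 1) - 1)).image (fun t => ((Lc ^ (k + 1) : ℕ) : ℤ) • y + toSite t),
                Real.exp (-(δ / 4) * l1 (v - u))
              + ∑ v ∈ ((box (d + 1) (Lc ^ (k + 1))).filter (fun t => t μ = 0)).image (fun t => ((Lc ^ (k + 1) : ℕ) : ℤ) • y + toSite t - unitVec μ),
                  Real.exp (-(δ / 4) * l1 (v - u))))
        * Real.exp (-(δ / 32) * (l1 (x - u) + l1 (z - u))) := by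
  have h := abs_unitS_superblock_sum_le' hG hδ hS hM hM2 hlaw hΨ hσ sf sm (Lc ^ k) y κ u x z a b
  rw [← pow_succ'] at h
  exact h

end Letter

end Summit.QuantumFields.BalabanUV.Beta.GAN24.LayerLetterEnd

end
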